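import Literature.AnabelianGeometry.AbsoluteAnabelian.AbsTopIII.Thm19CuspidalDegreeUnique
import HarnessLib

/-!
# Zero sets and descent of continuous crossed homomorphisms; kernels of restriction on `H¹`
# (Mathlib `continuousCohomology`, generic)

Generic companion of `ContCohomologyCrossedHomClass.lean` / `ContCohomologyCrossedHomPrincipal.lean`
(classes of continuous crossed homomorphisms `f : G → X`, `f (x y) = f x + x • f y`, in Mathlib's
`H¹(G, X) = continuousCohomology 1 X`, [cite: SerreGaloisCohomology1997, I §2.3]) and of the
surjectivity `exists_crossedHomClass_eq` (`Thm19CuspidalDegreeUnique.lean`).  De-specialised from the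
abc-iut proof of [AbsTopIII] Prop. 1.6 (iii) (`KummerPUKerOfWeightLaw.lean`, intrinsic cyclotome) so
that the same mechanism serves every "exactness at `H¹(Π_U, M)` by restriction to inertia subgroups"
statement ([AbsCusp] Prop. 2.1 (ii), [AbsTopIII] Prop. 1.6 (iii) / 1.8, [GalSect] §3):

* `apply_eq_zero_of_map_crossedHomClass_eq_zero` — if the pull-back of `[f]` along `ι : I → G`
  vanishes and `I` acts trivially through `ι`, then `f ∘ ι = 0` (`H¹(I, X) = Hom_cont(I, X)`);
  converse `map_crossedHomClass_eq_zero_of_apply_eq_zero`;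
* `apply_eq_zero_of_mem_closure_normalClosure` — for a closed normal subgroup `N ⊴ G` acting
  trivially on `X` (`X` T₁), the zero set of `f` inside `N` is a CLOSED NORMAL subgroup
  (`f(g n g⁻¹) = g • f(n)`), so `f` kills the closed normal closure of any `T ⊆ N` it kills;
* `crossedHom_descends_of_surjective` — along a continuous surjection `φ : G' → G` (`G'` compact, `G`
  Hausdorff, hence a quotient map) a continuous crossed homomorphism `G' → Y` for the action through
  `φ` that kills `Ker φ` is `F̄ ∘ φ` for a continuous crossed homomorphism `F̄ : G → Y` (inflation at
  the level of crossed homomorphisms; cf. `ContCohomologyInflation.deflate`, which needs ALL crossed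
  homomorphisms to kill the kernel);
* `map_restrict_eq_zero_of_kernel_generated` — the packaged `H¹` statement: if `Ker φ` is the closed
  normal subgroup generated by subgroups `I_c ≤ N'` (`c ∈ S`), a class of `H¹(G', Y|_{G'})` that dies
  on every `I_c` dies on `N'` as soon as every continuous crossed homomorphism `G → Y` killing the
  images of the `I_c` (test set `T₀`) kills `φ(N') ⊆ N` ("weight law" / base case supplied by the user).

All declarations are theorems; generic, no anabelian content; nothing here bears on [IUTchIII] Cor. 3.12.
-/

noncomputable section

open CategoryTheory TopRep ContRepresentation Topology

namespace ContinuousCohomology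

universe u v

variable {k : Type u} [Ring k] [TopologicalSpace k]
variable {G : Type v} [Group G] [TopologicalSpace G] [IsTopologicalGroup G]
variable (X : TopRep.{v} k G)

/-! ### Restriction classes versus values of the crossed homomorphism -/

/-- **A vanishing pull-back class forces vanishing values** when the source acts trivially: for
`ι : I → G` with `I` acting trivially on `X` through `ι`, if `ι^*[f] = 0` in `H¹(I, X|_I)` then
`f (ι i) = 0` for all `i` (`H¹(I, X) = Hom_cont(I, X)` for a trivial action).
[cite: SerreGaloisCohomology1997, I §2.3] -/
theorem apply_eq_zero_of_map_crossedHomClass_eq_zero {I : Type v} [Group I] [TopologicalSpace I]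
    [IsTopologicalGroup I] (ι : I →ₜ* G) (htriv : ∀ (i : I) (x : X), X.ρ (ι i) x = x)
    (f : C(G, X)) (hf : ∀ x y, f (x * y) = f x + X.ρ x (f y))
    (h0 : (map ι (𝟙 (res (ι : I →* G) X)) 1).hom (crossedHomClass X f hf) = 0) :
    ∀ i, f (ι i) = 0 := by
  have htriv' : ∀ (i : I) (x : res (ι : I →* G) X), (res (ι : I →* G) X).ρ i x = x :=
    fun i x => htriv i x
  rw [map_crossedHomClass] at h0
  have h3 := eq_zero_of_crossedHomClass_eq_zero _ htriv' _ _ h0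
  intro i
  exact congrArg (fun g => g i) h3

/-- Conversely, if `f ∘ ι = 0` then `ι^*[f] = 0` (the pulled-back crossed homomorphism is the zero
map, principal with vector `0`). [cite: SerreGaloisCohomology1997, I §2.3] -/
theorem map_crossedHomClass_eq_zero_of_apply_eq_zero {I : Type v} [Group I] [TopologicalSpace I]
    [IsTopologicalGroup I] (ι : I →ₜ* G) (f : C(G, X)) (hf : ∀ x y, f (x * y) = f x + X.ρ x (f y))
    (h : ∀ i, f (ι i) = 0) :
    (map ι (𝟙 (res (ι : I →* G) X)) 1).hom (crossedHomClass X f hf) = 0 := by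
  rw [map_crossedHomClass, crossedHomClass_eq_zero_iff]
  refine ⟨0, ?_, fun i => ?_⟩
  · simp only [map_zero]
    exact continuous_const
  · rw [map_zero, sub_zero]
    exact h i

/-! ### The zero set of a crossed homomorphism inside a trivially acting closed normal subgroup -/

/-- **Zero sets absorb closed normal closures**: let `N ⊴ G` be a closed normal subgroup acting
trivially on the `T₁` module `X`, `f : G → X` a continuous crossed homomorphism vanishing on a subset
`T ⊆ N`.  Then `f` vanishes on the closed normal subgroup of `G` generated by `T`: indeed
`{n ∈ N | f n = 0}` is a subgroup (on `N`, `f` is a homomorphism), normal by `f(g n g⁻¹) = g • f(n)`,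
and closed. [cite: SerreGaloisCohomology1997, I §2.3] -/
theorem apply_eq_zero_of_mem_closure_normalClosure [T1Space X] (N : Subgroup G) [N.Normal]
    (hNc : IsClosed (N : Set G)) (hN : ∀ n ∈ N, ∀ x : X, X.ρ n x = x)
    (f : C(G, X)) (hf : ∀ x y, f (x * y) = f x + X.ρ x (f y))
    {T : Set G} (hT : T ⊆ N) (hfT : ∀ t ∈ T, f t = 0) {g : G}
    (hg : g ∈ (Subgroup.normalClosure T).topologicalClosure) : f g = 0 := by
  -- the subgroup `W = {n ∈ N | f n = 0}`
  let W : Subgroup G :=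
    { carrier := {d | d ∈ N ∧ f d = 0}
      mul_mem' := by
        rintro a b ⟨ha, hfa⟩ ⟨hb, hfb⟩
        refine ⟨mul_mem ha hb, ?_⟩
        rw [hf, hfa, hfb, map_zero, add_zero]
      one_mem' := ⟨one_mem _, crossedHom_map_one _ f hf⟩
      inv_mem' := by
        rintro a ⟨ha, hfa⟩
        refine ⟨inv_mem ha, ?_⟩
        have h := hf a a⁻¹
        rw [mul_inv_cancel, crossedHom_map_one _ f hf, hfa, zero_add, hN a ha] at h
        exact h.symm }
  have hWn : W.Normal := by
    refine ⟨fun d hd x => ?_⟩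
    obtain ⟨hd, hfd⟩ := hd
    refine ⟨‹N.Normal›.conj_mem d hd x, ?_⟩
    have key : f (x * d * x⁻¹) = f (x * x⁻¹) := by
      rw [mul_assoc, hf x (d * x⁻¹), hf d x⁻¹, hfd, zero_add, hN d hd, hf x x⁻¹]
    show f (x * d * x⁻¹) = 0
    rw [key, mul_inv_cancel, crossedHom_map_one _ f hf]
  have hle : Subgroup.normalClosure T ≤ W := by
    haveI := hWn
    exact Subgroup.normalClosure_le_normal fun t ht => ⟨hT ht, hfT t ht⟩
  have hWc : IsClosed (W : Set G) := by
    have hset : (W : Set G) = (N : Set G) ∩ f ⁻¹' {0} := Set.ext fun _ => Iff.rfl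
    rw [hset]
    exact hNc.inter (isClosed_singleton.preimage f.continuous)
  exact (Subgroup.topologicalClosure_minimal _ hle hWc hg).2

/-! ### Descent along a surjection of compact groups -/

omit [IsTopologicalGroup G] in
/-- **Descent (inflation) of a crossed homomorphism**: let `φ : G' → G` be a continuous surjective
homomorphism with `G'` compact and `G` Hausdorff (so `φ` is a quotient map), `Y` a topological
`G`-module, and `F : G' → Y` a continuous crossed homomorphism for the action through `φ` that kills
`Ker φ`.  Then `F = F̄ ∘ φ` for a (unique) continuous crossed homomorphism `F̄ : G → Y`.
[cite: SerreGaloisCohomology1997, I §2.4] -/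
theorem crossedHom_descends_of_surjective {G' : Type v} [Group G'] [TopologicalSpace G']
    [IsTopologicalGroup G'] [CompactSpace G'] [T2Space G] (φ : G' →ₜ* G)
    (hφ : Function.Surjective φ) (Y : TopRep.{v} k G) (F : C(G', Y))
    (hF : ∀ a b, F (a * b) = F a + Y.ρ (φ a) (F b)) (hker : ∀ g, φ g = 1 → F g = 0) :
    ∃ Fb : C(G, Y), (∀ x y, Fb (x * y) = Fb x + Y.ρ x (Fb y)) ∧ ∀ g, Fb (φ g) = F g := by
  -- `F` is constant on the fibres of `φ`
  have hfib : ∀ a b, φ a = φ b → F a = F b := by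
    intro a b hab
    have hk : φ (a⁻¹ * b) = 1 := by
      rw [map_mul, map_inv, hab, inv_mul_cancel]
    symm
    calc F b = F (a * (a⁻¹ * b)) := by rw [mul_inv_cancel_left]
      _ = F a + Y.ρ (φ a) (F (a⁻¹ * b)) := hF _ _
      _ = F a := by rw [hker _ hk, map_zero, add_zero]
  let s : G → G' := Function.surjInv hφ
  have hs : ∀ y, φ (s y) = y := Function.surjInv_eq hφ
  let Fb : G → Y := fun y => F (s y)
  have hFb : ∀ g, Fb (φ g) = F g := fun g => hfib _ _ (hs (φ g))
  have hcont : Continuous Fb := by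
    have hq : IsQuotientMap φ :=
      ((map_continuous φ).isClosedMap).isQuotientMap (map_continuous φ) hφ
    rw [hq.continuous_iff]
    have hcomp : Fb ∘ φ = F := funext hFb
    rw [hcomp]
    exact F.continuous
  refine ⟨⟨Fb, hcont⟩, fun x y => ?_, hFb⟩
  obtain ⟨a, rfl⟩ := hφ x
  obtain ⟨b, rfl⟩ := hφ y
  show Fb (φ a * φ b) = Fb (φ a) + Y.ρ (φ a) (Fb (φ b))
  rw [← map_mul, hFb, hFb, hFb, hF]

/-! ### The packaged statement on `H¹` -/

omit [IsTopologicalGroup G] in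
/-- **Kernel of restriction on `H¹` when `Ker φ` is generated by inertia-like subgroups**: let
`φ : G' ↠ G` be a continuous surjection (`G'` compact, `G` Hausdorff), `Y` a `T₁` topological
`G`-module, `N' ⊴ G'` a closed normal subgroup acting trivially on `Y` through `φ` and mapping into the
subgroup `N ≤ G`, and `I_c ≤ N'` (`c ∈ S`) subgroups such that `Ker φ` is the closed normal subgroup
generated by the `I_c`.  Suppose ("weight law" / base case, supplied by the user) every continuous
crossed homomorphism `G → Y` that kills a test set `T₀ ⊆ ⋃_c φ(I_c)` kills `N`.  Then a class of
`H¹(G', Y|_{G'})` whose restriction to every `I_c` vanishes has vanishing restriction to `N'`.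
[cite: SerreGaloisCohomology1997, I §2.4] -/
theorem map_restrict_eq_zero_of_kernel_generated {G' : Type v} [Group G'] [TopologicalSpace G']
    [IsTopologicalGroup G'] [CompactSpace G'] [T2Space G] (φ : G' →ₜ* G)
    (hφ : Function.Surjective φ) (Y : TopRep.{v} k G) [T1Space Y]
    (N' : Subgroup G') [N'.Normal] (hN'c : IsClosed (N' : Set G'))
    (hN' : ∀ n ∈ N', ∀ y : Y, Y.ρ (φ n) y = y)
    {ι : Type v} (I : ι → Subgroup G') (hI : ∀ c, I c ≤ N') {S : Set ι}
    (hker : φ.toMonoidHom.ker =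
      (Subgroup.normalClosure (⋃ c ∈ S, (I c : Set G'))).topologicalClosure)
    (N : Subgroup G) (hNN : ∀ n ∈ N', φ n ∈ N)
    (T₀ : Set G) (hT₀ : ∀ t ∈ T₀, ∃ c, ∃ g ∈ I c, φ g = t)
    (hW : ∀ Fb : C(G, Y), (∀ x y, Fb (x * y) = Fb x + Y.ρ x (Fb y)) →
      (∀ t ∈ T₀, Fb t = 0) → ∀ n ∈ N, Fb n = 0)
    (γ : continuousCohomology 1 (res (φ : G' →* G) Y))
    (hγ : ∀ c, (map ({ toMonoidHom := (I c).subtype, continuous_toFun := continuous_subtype_val } :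
        I c →ₜ* G') (𝟙 _) 1).hom γ = 0) :
    (map ({ toMonoidHom := N'.subtype, continuous_toFun := continuous_subtype_val } : N' →ₜ* G')
      (𝟙 _) 1).hom γ = 0 := by
  haveI : T1Space (res (φ : G' →* G) Y) := ‹T1Space Y›
  obtain ⟨F, hF, rfl⟩ := exists_crossedHomClass_eq (res (φ : G' →* G) Y) γ
  -- `F` vanishes on each `I_c`
  have hFI : ∀ c, ∀ i ∈ I c, F i = 0 := by
    intro c i hi
    exact apply_eq_zero_of_map_crossedHomClass_eq_zero (res (φ : G' →* G) Y)
      ({ toMonoidHom := (I c).subtype, continuous_toFun := continuous_subtype_val } : I c →ₜ* G')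
      (fun j y => hN' j (hI c j.2) y) F hF (hγ c) ⟨i, hi⟩
  -- hence on `Ker φ`
  have hFker : ∀ g, φ g = 1 → F g = 0 := by
    intro g hg
    have hg' : g ∈ (Subgroup.normalClosure (⋃ c ∈ S, (I c : Set G'))).topologicalClosure := by
      rw [← hker]
      exact hg
    refine apply_eq_zero_of_mem_closure_normalClosure (res (φ : G' →* G) Y) N' hN'c
      (fun n hn y => hN' n hn y) F hF ?_ ?_ hg'
    · intro t ht
      obtain ⟨c, -, htc⟩ := Set.mem_iUnion₂.1 ht
      exact hI c htc
    · intro t ht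
      obtain ⟨c, -, htc⟩ := Set.mem_iUnion₂.1 ht
      exact hFI c t htc
  -- descend and apply the law on `G`
  obtain ⟨Fb, hFb, hFbF⟩ := crossedHom_descends_of_surjective φ hφ Y F (fun a b => hF a b) hFker
  have hFbT : ∀ t ∈ T₀, Fb t = 0 := by
    intro t ht
    obtain ⟨c, g, hg, rfl⟩ := hT₀ t ht
    rw [hFbF]
    exact hFI c g hg
  have hFN : ∀ n ∈ N', F n = 0 := fun n hn => by
    rw [← hFbF n]
    exact hW Fb hFb hFbT _ (hNN n hn)
  exact map_crossedHomClass_eq_zero_of_apply_eq_zero (res (φ : G' →* G) Y)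
    ({ toMonoidHom := N'.subtype, continuous_toFun := continuous_subtype_val } : N' →ₜ* G') F hF
    fun n => hFN n n.2

end ContinuousCohomology
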